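import Mathlib

/-!
# SoloBlind.AnchorLegendre — at the D₈ anchor the Weil relation (V) is a formal identity in the period dictionary

Companion of `SoloBlindAnchorFrame` and `SoloBlindWeilDetFlat` (solo-blind programme, `paper/weil-det.md` §4 and
`paper/selfref-s60.md` §C).  For the real hyperelliptic family `y² = x(x²−a²)(x²−b²)(x²−c²)` the programme's
PROPOSITION V says `D_even = −π·Ω_E/(3√(abc))`, `D_odd = π²√(abc)/(5Ω_E)` for the 3×3 real gap-period determinants.
At the anchor `(a,b,c) = (√2−1, 1, √2+1)` (`abc = 1`):

* ROW REDUCTION (selfref-s60 §C.3, rules 2+3 only): the automorphism `κ : (x,y) ↦ (1/x, iy/x⁴)` makes row 1 of each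
  adapted period matrix the (sign-twisted) copy of row 2, so the determinants collapse to 2×2 minors:
  `det[(ρ,−s,−q);(ρ,s,q);(ρ,s₃,q₃)] = 2ρ(s q₃ − s₃ q)` (`row_reduction_even`) and
  `det[(w,t,−Q);(w,t,Q);(w₃,t₃,Q₃)] = −2Q(w t₃ − w₃ t)` (`row_reduction_odd`).
* DICTIONARY (90-digit PSLQ identifications, kit job j223544, residuals ≤ 2e-86; `O = Ω₂ = Γ(1/8)Γ(3/8)/(4√(2π))`,
  `P = π/Ω₂`, `s = sin(π/8)`, `c = cos(π/8)`, `r = √2`):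
  `r_{2,−} = −sO`, `r_{3,−} = −cO`, `q₂ = −(3/2)sO − ((2+r)/3)sP`, `q₃ = −(3/2)cO + (r/3)sP`,
  `w₂ = −cO/2`, `w₃ = −sO/2`, `t₂ = (9/2)cO + r s P`, `t₃ = (9/2)sO − (2+r)sP`.
* THIS FILE: given the dictionary, the two "Weil-divisor" minors are FORMAL identities in `O, P`:
  `N₂₃ := r_{2,−}q₃ − r_{3,−}q₂ = −(r/3)·(O·P)` and `m₁ := w₂t₃ − w₃t₂ = (r/2)·(O·P)` — the `O²` terms cancel and
  what is left is the single identity `r s² + (2+r) s c = r` of `ℚ(ζ₈)⁺` (`trig_identity`, and its real instance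
  `trig_identity_pi_div_eight`).  With `O·P = π`, `ρ = r_{2,+} = Ω_E/√2` and `Q₂ = √2·π/Ω_E` this is exactly
  `D_even = −πΩ_E/3`, `D_odd = π²/(5Ω_E)` (`value_even`, `value_odd`).

So the only non-formal input of the anchor argument is the dictionary itself (first-kind entries: the
`ℚ(ζ₈)`-correspondence `J(C₂) → E₂²`; second-kind entries: the same plus Legendre for `E₂`), as recorded in
weil-det §4.  Bearing on `KZPeriodConjecture`: none directly (by-product certificate).  Mathlib only.
-/

namespace Summit.KontsevichZagierPeriods.KontsevichZagierPeriods.Theorems.SoloBlind.AnchorLegendre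

open Real

/-- Row reduction in the even adapted frame: if row 1 is `(ρ, −s, −q)` against row 2 `(ρ, s, q)`, the 3×3
determinant is `2ρ` times the 2×2 minor of rows 2, 3 in the last two columns. -/
theorem row_reduction_even {R : Type*} [CommRing R] (ρ s q s₃ q₃ : R) :
    Matrix.det !![ρ, -s, -q; ρ, s, q; ρ, s₃, q₃] = 2 * ρ * (s * q₃ - s₃ * q) := by
  simp [Matrix.det_fin_three]; ring

/-- Row reduction in the odd adapted frame: if row 1 is `(w, t, −Q)` against row 2 `(w, t, Q)`, the 3×3
determinant is `−2Q` times the 2×2 minor of rows 2, 3 in the first two columns. -/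
theorem row_reduction_odd {R : Type*} [CommRing R] (w t Q w₃ t₃ Q₃ : R) :
    Matrix.det !![w, t, -Q; w, t, Q; w₃, t₃, Q₃] = -2 * Q * (w * t₃ - w₃ * t) := by
  simp [Matrix.det_fin_three]; ring

/-- The identity of `ℚ(ζ₈)⁺` behind the anchor: `r s² + (2 + r) s c = r` whenever `4s² = 2 − r` and
`4sc = r` (for `s = sin(π/8)`, `c = cos(π/8)`, `r = √2`).  Stated ×4 so that it holds in any commutative ring. -/
theorem trig_identity {R : Type*} [CommRing R] (r s c : R) (h2 : 4 * s ^ 2 = 2 - r) (h3 : 4 * s * c = r) :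
    4 * (r * s ^ 2 + (2 + r) * s * c) = 4 * r := by
  linear_combination r * h2 + (2 + r) * h3

/-- `4 sin²(π/8) = 2 − √2`. -/
theorem four_sin_sq_pi_div_eight : 4 * sin (π / 8) ^ 2 = 2 - √2 := by
  have h := cos_two_mul (π / 8)
  rw [show 2 * (π / 8) = π / 4 by ring, cos_pi_div_four] at h
  have hs := sin_sq_add_cos_sq (π / 8)
  linear_combination 4 * hs + 2 * h

/-- `4 sin(π/8) cos(π/8) = √2`. -/
theorem four_sin_cos_pi_div_eight : 4 * sin (π / 8) * cos (π / 8) = √2 := by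
  have h := sin_two_mul (π / 8)
  rw [show 2 * (π / 8) = π / 4 by ring, sin_pi_div_four] at h
  linear_combination (-2) * h

/-- Real instance of `trig_identity`: `√2·sin²(π/8) + (2 + √2)·sin(π/8)cos(π/8) = √2`. -/
theorem trig_identity_pi_div_eight :
    √2 * sin (π / 8) ^ 2 + (2 + √2) * sin (π / 8) * cos (π / 8) = √2 := by
  have h := trig_identity (√2) (sin (π / 8)) (cos (π / 8)) four_sin_sq_pi_div_eight four_sin_cos_pi_div_eight
  linarith

/-- EVEN FRAME, formal: with the dictionary values of `r_{2,−}, r_{3,−}, q₂, q₃` the Weil-divisor minor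
`N₂₃ = r_{2,−}·q₃ − r_{3,−}·q₂` equals `−(r/3)·(O·P)` for ALL `O, P`, given only `4s² = 2 − r`, `4sc = r`. -/
theorem weilMinor_even (r s c O P : ℝ) (h2 : 4 * s ^ 2 = 2 - r) (h3 : 4 * s * c = r) :
    (-s * O) * (-(3 / 2) * c * O + r / 3 * s * P) - (-c * O) * (-(3 / 2) * s * O - (2 + r) / 3 * s * P)
      = -(r / 3) * (O * P) := by
  linear_combination (-(O * P) / 12) * (r * h2 + (2 + r) * h3)

/-- ODD FRAME, formal: with the dictionary values of `w₂, w₃, t₂, t₃` the minor `m₁ = w₂·t₃ − w₃·t₂` equals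
`(r/2)·(O·P)` for ALL `O, P`, given only `4s² = 2 − r`, `4sc = r`. -/
theorem weilMinor_odd (r s c O P : ℝ) (h2 : 4 * s ^ 2 = 2 - r) (h3 : 4 * s * c = r) :
    (-c * O / 2) * (9 / 2 * s * O - (2 + r) * s * P) - (-s * O / 2) * (9 / 2 * c * O + r * s * P)
      = r / 2 * (O * P) := by
  linear_combination ((O * P) / 8) * (r * h2 + (2 + r) * h3)

/-- The even minor at the actual anchor values `s = sin(π/8)`, `c = cos(π/8)`, `r = √2`:
`N₂₃ = −(√2/3)·(O·P)`; with `O·P = Ω₂·(π/Ω₂) = π` this is `N₂₃ = −(√2/3)π` (selfref-s60 §C.3, to 90 digits). -/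
theorem weilMinor_even_anchor (O P : ℝ) :
    (-sin (π / 8) * O) * (-(3 / 2) * cos (π / 8) * O + √2 / 3 * sin (π / 8) * P)
      - (-cos (π / 8) * O) * (-(3 / 2) * sin (π / 8) * O - (2 + √2) / 3 * sin (π / 8) * P)
      = -(√2 / 3) * (O * P) :=
  weilMinor_even _ _ _ O P four_sin_sq_pi_div_eight four_sin_cos_pi_div_eight

/-- The odd minor at the actual anchor values: `m₁ = (√2/2)·(O·P)` (= `π/√2` when `O·P = π`). -/
theorem weilMinor_odd_anchor (O P : ℝ) :
    (-cos (π / 8) * O / 2) * (9 / 2 * sin (π / 8) * O - (2 + √2) * sin (π / 8) * P)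
      - (-sin (π / 8) * O / 2) * (9 / 2 * cos (π / 8) * O + √2 * sin (π / 8) * P)
      = √2 / 2 * (O * P) :=
  weilMinor_odd _ _ _ O P four_sin_sq_pi_div_eight four_sin_cos_pi_div_eight

/-- Assembly, even: `D_even = ρ·N₂₃` with `ρ = Ω_E/√2` and `N₂₃ = −(√2/3)·π` gives `D_even = −π·Ω_E/3`,
i.e. PROPOSITION V at `abc = 1`. -/
theorem value_even (ΩE π' : ℝ) : ΩE / √2 * (-(√2 / 3) * π') = -(π' * ΩE) / 3 := by
  have h : √2 ≠ 0 := by positivity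
  field_simp

/-- Assembly, odd: `−10·D_odd = −2·Q₂·m₁` with `Q₂ = √2·π/Ω_E` and `m₁ = (√2/2)·π` gives `D_odd = π²/(5Ω_E)`,
i.e. PROPOSITION V (odd frame) at `abc = 1`. -/
theorem value_odd (ΩE π' D : ℝ) (hΩ : ΩE ≠ 0) (h : -10 * D = -2 * (√2 * π' / ΩE) * (√2 / 2 * π')) :
    D = π' ^ 2 / (5 * ΩE) := by
  have h2 : √2 * √2 = 2 := Real.mul_self_sqrt (by norm_num)
  field_simp
  field_simp at h
  nlinarith [h, h2]

end Summit.KontsevichZagierPeriods.KontsevichZagierPeriods.Theorems.SoloBlind.AnchorLegendre
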